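/-
Copyright (c) 2026 the pub-hodgecm-mathlib formalisation cell (harness21).  Prover seat hodgecm-mathlib-LH4-p15 (g0), req620 Track A «(D-RAM) FOUR-FRAME» squad
((β₂) road (R-36) «PURE-CELL LEDGER»; (AX-sh-C) = the lane-C (RamM) twin of ★ p862542 `F0P3cDyRamAxisLetterEstimates`, dealt by LH4-p12 (g8) 22:39:53Z «YOURS — the lane-C
twin»; letters per LH4-p12's memo `AXIS-HDICH-LANEC-SCOPING.v1` (2c5dc5b5) and `beta2CellsCFrame.letter.v1` (931c87fe)), 2026-09-04.
-/
import Summits.HodgeConjecture.HodgeConjecture.Theorems.F0P3cDyRamAxisLetterEstimates     -- ★ p862542 (this seat): brings ★ p862503 toolkit (coordinates, expansion, depth trace, skew gain of a datum), ★ `ray_eq_valueSetMod_smul_xPlus`, ★ `exists_skew_near_of_trace_deep`, ★ `isOrd_mul`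
import Summits.HodgeConjecture.HodgeConjecture.Theorems.F0P3cDyRamAxisLetterToolkitRamM   -- ★ (this seat, (AX-sh-C) toolkit): lane-C sizes, `κ`-facts, lower token with skew parity
import Summits.HodgeConjecture.HodgeConjecture.Theorems.F0P3cDyRamEisensteinDepthRamK    -- ★ (F0P3a lineage): `eq_exp_of_mul_self_eq` (in `ℤᵐ⁰`)
import HarnessLib

/-!
# Crux `H413`, line LH4 «(D-RAM) FOUR-FRAME» — STAGE-1b, row (2), the (β₂) road (R-36), row (AX-sh-C): «THE LETTER OF AN AXIS VERTEX IS ONE CLASS» IN LANE C (RamM) —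
# the line-model estimates when `M ∕ E` is RAMIFIED (`|jE a| = |a|²`, `α − ρα = ϖM − ρϖM`, `IsRamifiedQuadraticDatum ρ ϖM dρ tρ`), under the two DEEP letters of the
# V-shrink (`|lam − 1| ≤ |jE ϖ^{k′}|`, `|u₀ − 1| ≤ |ϖ^{m′}|`): the `ϖ^m`-letter `{Tr_ρ(κ(lam − jE u₀)·ζΘζ) : ζ ∈ 𝒪_j} + 𝔭^m` is `valueSetMod σ ϖ m (e • X₊)`, `σe = e`, `|e| = 1`

Cell `hodgecm-mathlib` (D-0151), FLOOR 0, crux item H413 = `stmt-HodgeConjecture-24833`, route of record `HCCMUnconditional`; squad F0∕P3c∕LH4; lane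
`--supports stmt-HodgeConjecture-24833 --as helper` (count-neutral; pays NO tier-0 row).  THEOREMS ONLY (no `def`, no instance, no notation, no `sorry`, default heartbeats);
★-only imports; states NO law; (β₂) stays a HYPOTHESIS.  DATUM-FREE over the lane-C line-model letters of `beta2CellsCFrame.letter.v1` (M-normalised valuation `|ϖM| = exp(−1)`,
`|jE a| = |a|²`, `α − ρα = ϖM − ρϖM`, the relative datum `IsRamifiedQuadraticDatum ρ ϖM dρ tρ`, the ★ DEFS `ρ∕Θ` letters) and the sheet datum `IsRamifiedQuadraticDatum σ ϖ d t` on `E`.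

WHY (LH4-p12 (g8) memo 2c5dc5b5 §2–§3; this seat's (AX-sh) files ★ p862503∕p862542∕p862589 for lanes A∕B).  In lane C the cross-term bound of ★ p862542 reads
`|X − ΘX| ≤ |ϖM|^{dρ − 2(d−1)}·|μ|` (`|κ| = |ϖM|^{−(2j + dρ)}` on a unimodular axis line), and the square token only gives `|μ| ≤ |ϖM|^{m_c}`: short by `dρ∕2` digits of `E`
(memo §2 «slack(d) ≥ dρ∕2»).  The (L-Σ-3C) assembler's V-shrink (★ `exists_nhds_one_block_congr`, the ★ p862116 pattern) supplies two DEEP letters at no cost — `hw′ : |lam − 1| ≤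
|jE ϖ^{k′}|` and `hum′ : |u₀ − 1| ≤ |ϖ^{m′}|` — and with them every estimate of ★ p862542 goes through with `dρ∕2` to spare; the LOWER token still pins the populated level
(`k′ ≤ j + ℓ₀`, by the SKEW PARITY of `ρ`: `|w − ρw| = exp(2n − dρ)`), so the shell column survives the shrink.  Arithmetic side conditions are explicit ℕ-inequalities `hC…` in
`m` (precision), `k` (`2k` = square level), `k′, m′` (deep letters), `n′` (a trace exponent), `r = dρ∕2`; at `m = m*`, `2k = m_c` they hold as soon as `k′, m′` are large.
* §1 `v_value_sub_ray_le'` — every value is `exp(−2m)`-close to its ray value (the expansion ★ `value_sub_ray_eq` and depth trace ★ `depth_add_map_eq` of ★ p862503, the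
  lane-C sizes of ★ `F0P3cDyRamAxisLetterToolkitRamM`); §2 `v_trace_depth_eq'` (`|S| = exp(−2ℓ₀)`), `v_trace_depth_add_map_le'` (`|S + ΘS| ≤ exp(−4k)`).
* §3 HEAD `exists_fixed_unit_lineValueSet_axis_eq_smul_xPlus_ramM`.
HONEST LABEL.  Count-neutral line-model algebra; nothing printed is asserted; no census law is stated; (β₂) and the typed letters stay HYPOTHESES; `HC_CM` is proved only modulo the 7
printed citations (2 remaining named inputs: hLiu418 = `stmt-HodgeConjecture-24832`, h413 = `stmt-HodgeConjecture-24833`) until rung 0 closes.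
## References
* [Serre1979] J.-P. Serre, *Local Fields*, GTM 67 (1979): Ch. III §3 Prop. 7, §6 Prop. 12–13, Ch. V §3 Cor. 3.  [Jacobowitz1962] R. Jacobowitz, *Hermitian forms over local fields*,
  Amer. J. Math. 84 (1962): §4.  [Rogawski1990] J. D. Rogawski, *Automorphic Representations of Unitary Groups in Three Variables*, Ann. of Math. Stud. 123 (1990): §4.9
  Prop. 4.9.1 (b) p. 55.  [Kottwitz1986BaseChangeUnits] R. E. Kottwitz, *Base change for unit elements of Hecke algebras*, Compositio Math. 60 (1986): §1 pp. 240–241.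
-/

set_option autoImplicit false

noncomputable section

namespace Summit.HodgeConjecture.HodgeConjecture.Cruxes.H413.F0P3cDyRamAxisLetterEstimatesRamM

open scoped Valued WithZero
open WithZero
open Literature.NumberTheory.Automorphic.UnitaryThreeFourFrame (IsRamifiedQuadraticDatum)
open Literature.NumberTheory.LocalFields.WildQuadraticDatum
open Summit.HodgeConjecture.HodgeConjecture.Cruxes.H413.F0P3cDyRamFourFramePieces
open Summit.HodgeConjecture.HodgeConjecture.Cruxes.H413.F0P3cDyRamToricCensusDefs
open Summit.HodgeConjecture.HodgeConjecture.Cruxes.H413.F0P3cDyRamShellLabelPlus (v_inv_varpi_pow_mul_le_one_iff)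
open Summit.HodgeConjecture.HodgeConjecture.Cruxes.H413.F0P3cDyRamFrameEltOneSlotLabel (valueSetMod_smul_xPlus_congr)
open Summit.HodgeConjecture.HodgeConjecture.Cruxes.H413.F0P3cDyRamValueSetSkewLineCriterion (exists_skew_near_of_trace_deep)
open Summit.HodgeConjecture.HodgeConjecture.Cruxes.H413.F0P3cDyRamDepthScalar (ray_eq_valueSetMod_smul_xPlus)
open Summit.HodgeConjecture.HodgeConjecture.Cruxes.H413.F0P3cDyRamShellLineModel (isOrd_mul)
open Summit.HodgeConjecture.HodgeConjecture.Cruxes.H413.F0P3cDyRamAxisLetterToolkit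
open Summit.HodgeConjecture.HodgeConjecture.Cruxes.H413.F0P3cDyRamAxisLetterToolkitRamM
open Summit.HodgeConjecture.HodgeConjecture.Cruxes.H413.F0P3cDyRamEisensteinDepthRamK (eq_exp_of_mul_self_eq)

variable {E M : Type} [Field E] [Valued E ℤᵐ⁰] [Field M] [Valued M ℤᵐ⁰] {σ : E →+* E} {ϖ : E} {d t : ℕ} {ρ Θ : M →+* M} {α ϖM : M} {dρ tρ : ℕ}

/-! ## §1 Every value is `exp(−2m)`-close to its ray value (lane C) -/

/-- **EVERY VALUE IS `exp(−2m)`-CLOSE TO ITS RAY VALUE (lane C).**  Letters: `|jE a| = |a|²`, the relative datum `(ρ, ϖM, dρ)` with `α − ρα = ϖM − ρϖM`, `dρ = 2r`, the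
`κ` of a unimodular axis line (`Θκ = κ`, `|κ|·|jE ϖ^j|·|α − ρα| = 1`), `Θlam·lam = 1`, the deep letters `|lam − 1| ≤ |jE ϖ^{k′}|`, `|u₀ − 1| ≤ |ϖ^{m′}|`, the lower and square-free
tokens, and `hC1 : m + r ≤ k′ + d − 1` (cross term, skew gain of `σ`), `hC3 : m + r ≤ 2n′`, `hC3′ : 2n′ ≤ m′ + d` (the `Tr_σ(u₀ − 1)` piece), `hC4 : m + r + ℓ₀ ≤ 2k′`
(the `w²` piece and the `α`-square piece, with `k′ ≤ j + ℓ₀` from the lower token), `hC5 : ℓ₀ + 1 ≤ k′`, `hC9 : k′ ≤ m′`.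
[cite: Jacobowitz1962, §4] [cite: Serre1979, Ch. III §3 Prop. 7, §6 Prop. 13] [cite: Rogawski1990, §4.9 Prop. 4.9.1 (b) p. 55] -/
theorem v_value_sub_ray_le' (hD : IsRamifiedQuadraticDatum σ ϖ d t) (jE : E →+* M) (hjsq : ∀ a, Valued.v (jE a) = Valued.v a ^ 2)
    (hjfix : ∀ z, ρ z = z ↔ ∃ c, jE c = z) (hΘj : ∀ x, Θ (jE x) = jE (σ x))
    (hρρ : ∀ x, ρ (ρ x) = x) (hvρ : ∀ x, Valued.v (ρ x) = Valued.v x) (hΘΘ : ∀ x, Θ (Θ x) = x) (hΘρ : ∀ x, Θ (ρ x) = ρ (Θ x))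
    (hvΘ : ∀ x, Valued.v (Θ x) = Valued.v x) (hα1 : Valued.v α ≤ 1) (hDρ : IsRamifiedQuadraticDatum ρ ϖM dρ tρ) (hαρ : α - ρ α = ϖM - ρ ϖM)
    {r : ℕ} (hr : dρ = 2 * r)
    {κ : M} (hΘκ : Θ κ = κ) {j : ℕ} (hκY : Valued.v κ * Valued.v (jE ϖ ^ j) * Valued.v (α - ρ α) = 1)
    {lam : M} (hlam : Θ lam * lam = 1) {u₀ : E} {m k' m' n' : ℕ}
    (hw' : Valued.v (lam - 1) ≤ Valued.v (jE ϖ ^ k')) (hum' : Valued.v (u₀ - 1) ≤ Valued.v (ϖ ^ m'))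
    (hlev : IsOrd ρ α (jE ϖ ^ j) ((lam - 1) / jE ϖ ^ (d % 2))) (hnlev : ¬ IsOrd ρ α (jE ϖ ^ j) ((lam - 1) / jE ϖ ^ (d % 2 + 1)))
    (hC1 : m + r ≤ k' + d - 1) (hC3 : m + r ≤ 2 * n') (hC3' : 2 * n' ≤ m' + d) (hC4 : m + r + d % 2 ≤ 2 * k') (hC5 : d % 2 + 1 ≤ k') (hC9 : k' ≤ m')
    {ζ : M} (hζ : IsOrd ρ α (jE ϖ ^ j) ζ) :
    Valued.v ((κ * (lam - jE u₀) * ((ζ * Θ ζ)) + ρ (κ * (lam - jE u₀) * (ζ * Θ ζ))) -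
        (ζ - (ζ - ρ ζ) / (α - ρ α) * α) * Θ (ζ - (ζ - ρ ζ) / (α - ρ α) * α) * (κ * (lam - jE u₀) + ρ (κ * (lam - jE u₀)))) ≤ exp (-(2 * (m : ℤ))) := by
  have hD' := hD
  obtain ⟨hσ, hvσ, hϖ, hfix, hd, h1d, ht⟩ := hD
  have hϖM : Valued.v ϖM = exp (-1 : ℤ) := hDρ.2.2.1
  have hvαρ : Valued.v (α - ρ α) = exp (-(dρ : ℤ)) := by rw [hαρ, hDρ.2.2.2.2.1, v_varpi_pow hϖM]
  have hα : ρ α ≠ α := fun h => by rw [h, sub_self, map_zero] at hvαρ; exact exp_ne_zero hvαρ.symm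
  -- sizes of the letters
  have hpow := v_map_varpi_pow_sq hϖ jE hjsq
  have hcc : Valued.v (jE ϖ ^ j) = exp (-(2 * (j : ℤ))) := hpow j
  have hcc1 : Valued.v (jE ϖ ^ j) ≤ 1 := by rw [hcc, ← exp_zero, exp_le_exp]; omega
  have hκ : Valued.v κ = exp (2 * (j : ℤ) + dρ) := by
    have e : Valued.v κ = Valued.v κ * Valued.v (jE ϖ ^ j) * Valued.v (α - ρ α) * (exp (2 * (j : ℤ) + dρ)) := by
      rw [hcc, hvαρ, mul_assoc, mul_assoc, ← exp_add, ← exp_add]; simp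
    rw [e, hκY, one_mul]
  have hw : Valued.v (lam - 1) ≤ exp (-(2 * (k' : ℤ))) := by rw [hpow] at hw'; exact hw'
  have hμ : Valued.v (lam - jE u₀) ≤ exp (-(2 * (k' : ℤ))) := by
    have e : lam - jE u₀ = (lam - 1) - jE (u₀ - 1) := by rw [map_sub, map_one]; ring
    rw [e]
    refine (Valuation.map_sub _ _ _).trans (max_le hw ?_)
    rw [hjsq]
    have hu : Valued.v (u₀ - 1) ≤ exp (-(m' : ℤ)) := by rw [map_pow, v_varpi_pow hϖ] at hum'; exact hum'
    refine (pow_le_pow_left' hu 2).trans ?_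
    rw [← exp_nsmul, nsmul_eq_mul, exp_le_exp]; push_cast; omega
  have hl1 : Valued.v lam = 1 := v_lam_eq_one hvΘ hlam
  have hl0 : lam ≠ 0 := fun h0 => by rw [h0, map_zero] at hl1; exact zero_ne_one hl1
  obtain ⟨-, hkj⟩ := v_sub_map_eq_of_tokens hϖ jE hjsq hjfix hDρ hαρ hw hC5 hlev hnlev
  set μ : M := lam - jE u₀ with hμdef
  set c : M := κ * μ with hcdef
  have hc : Valued.v c ≤ exp (2 * (j : ℤ) + dρ - 2 * k') := by
    rw [hcdef, map_mul, hκ, sub_eq_add_neg, exp_add]; exact mul_le_mul' le_rfl hμ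
  -- the coordinates of `ζ`
  obtain ⟨hB, hA⟩ := coords_fixed hρρ hα ζ
  obtain ⟨hB1, hA1⟩ := v_coords_le hα hα1 hcc1 hζ
  set B : M := (ζ - ρ ζ) / (α - ρ α) with hBdef
  set A : M := ζ - B * α with hAdef
  have hζAB : ζ = A + B * α := by simp [A]
  have hA' : ρ (Θ A) = Θ A := by rw [← hΘρ, hA]
  have hB' : ρ (Θ B) = Θ B := by rw [← hΘρ, hB]
  have hBj : Valued.v B ≤ exp (-(2 * (j : ℤ))) := hcc ▸ hB1
  -- the expansion
  have hexp := value_sub_ray_eq (Θ := Θ) (α := α) hA hB hA' hB' c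
  rw [← hζAB] at hexp
  rw [hexp]
  set P : M := c * α + ρ (c * α) with hPdef
  set P' : M := c * Θ α + ρ (c * Θ α) with hP'def
  set Q : M := c * (α * Θ α) + ρ (c * (α * Θ α)) with hQdef
  have hΘα1 : Valued.v (Θ α) ≤ 1 := by rw [hvΘ]; exact hα1
  have hP : Valued.v P ≤ exp (2 * (j : ℤ) + dρ - 2 * k') :=
    (v_add_map_le hvρ _).trans (by rw [Valuation.map_mul _ c]; exact (mul_le_of_le_one_right' hα1).trans hc)
  have hQ : Valued.v Q ≤ exp (2 * (j : ℤ) + dρ - 2 * k') :=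
    (v_add_map_le hvρ _).trans (by rw [Valuation.map_mul _ c, Valuation.map_mul _ α]; exact (mul_le_of_le_one_right' (mul_le_one' hα1 hΘα1)).trans hc)
  have hΘX : Θ (B * Θ A * P) = Θ B * A * Θ P := by rw [map_mul, map_mul, hΘΘ]
  rw [cross_regroup A B (Θ A) (Θ B) P P' (Θ P), ← hΘX]
  -- (i) the skew gain of `σ` on `X = BΘA·P`
  have hXfix : ρ (B * Θ A * P) = B * Θ A * P := by rw [map_mul, map_mul, hB, hA', hPdef, map_add_map_eq hρρ]
  have hX : Valued.v (B * Θ A * P) ≤ exp ((dρ : ℤ) - 2 * k') := by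
    rw [map_mul, map_mul, hvΘ]
    calc Valued.v B * Valued.v A * Valued.v P ≤ exp (-(2 * (j : ℤ))) * 1 * exp (2 * (j : ℤ) + dρ - 2 * k') := mul_le_mul' (mul_le_mul' hBj hA1) hP
      _ = exp ((dρ : ℤ) - 2 * k') := by rw [mul_one, ← exp_add]; congr 1; ring
  have hi : Valued.v (B * Θ A * P - Θ (B * Θ A * P)) ≤ exp (-(2 * (m : ℤ))) := by
    refine (v_sub_map_le_mul_of_fixed_sq hD' jE hjsq hjfix hΘj hXfix).trans ?_
    refine (mul_le_mul' hX le_rfl).trans ?_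
    rw [← exp_add, exp_le_exp]; omega
  -- (ii) the depth trace on `AΘB·(P′ + ΘP)`
  have hsum : P' + Θ P = (c + Θ c) * Θ α + ρ ((c + Θ c) * Θ α) := by
    rw [hP'def, hPdef, map_trace_mul_eq hΘρ c α, sum_traces_eq]
  have hcΘc : Valued.v (c + Θ c) ≤ exp (2 * (j : ℤ) + dρ - 2 * (m + r)) := by
    rw [hcdef, hμdef, depth_add_map_eq jE hΘj hΘκ hlam u₀, map_mul, hκ]
    have esplit : exp (2 * (j : ℤ) + dρ - 2 * (m + r)) = exp (2 * (j : ℤ) + dρ) * exp (-(2 * ((m : ℤ) + r))) := by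
      rw [← exp_add, ← sub_eq_add_neg]
    rw [esplit]
    refine mul_le_mul' le_rfl ((Valuation.map_sub _ _ _).trans (max_le ?_ ?_))
    · rw [map_mul, map_inv₀, hl1, inv_one, mul_one, map_pow, pow_two]
      refine (mul_le_mul' hw hw).trans ?_
      rw [← exp_add, exp_le_exp]; omega
    · rw [hjsq]
      have hu : Valued.v (u₀ - 1) ≤ exp (-(m' : ℤ)) := by rw [map_pow, v_varpi_pow hϖ] at hum'; exact hum'
      refine (pow_le_pow_left' (v_add_map_le_exp hσ hfix hϖ hd ht hu (m := n') (by omega)) 2).trans ?_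
      rw [← exp_nsmul, nsmul_eq_mul, exp_le_exp]; push_cast; omega
  have hii : Valued.v (A * Θ B * (P' + Θ P)) ≤ exp (-(2 * (m : ℤ))) := by
    rw [hsum, map_mul, map_mul, hvΘ]
    have hT : Valued.v ((c + Θ c) * Θ α + ρ ((c + Θ c) * Θ α)) ≤ exp (2 * (j : ℤ) + dρ - 2 * (m + r)) :=
      (v_add_map_le hvρ _).trans (by rw [map_mul]; exact (mul_le_of_le_one_right' hΘα1).trans hcΘc)
    calc Valued.v A * Valued.v B * Valued.v ((c + Θ c) * Θ α + ρ ((c + Θ c) * Θ α))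
        ≤ 1 * exp (-(2 * (j : ℤ))) * exp (2 * (j : ℤ) + dρ - 2 * (m + r)) := mul_le_mul' (mul_le_mul' hA1 hBj) hT
      _ ≤ exp (-(2 * (m : ℤ))) := by rw [one_mul, ← exp_add, exp_le_exp]; omega
  -- (iii) the `α`-square term by the lower token (`k′ ≤ j + ℓ₀`)
  have hiii : Valued.v (B * Θ B * Q) ≤ exp (-(2 * (m : ℤ))) := by
    rw [map_mul, map_mul, hvΘ]
    calc Valued.v B * Valued.v B * Valued.v Q
        ≤ exp (-(2 * (j : ℤ))) * exp (-(2 * (j : ℤ))) * exp (2 * (j : ℤ) + dρ - 2 * k') := mul_le_mul' (mul_le_mul' hBj hBj) hQ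
      _ ≤ exp (-(2 * (m : ℤ))) := by rw [← exp_add, ← exp_add, exp_le_exp]; omega
  refine (Valuation.map_add _ _ _).trans (max_le ((Valuation.map_add _ _ _).trans (max_le hi hii)) hiii)

/-! ## §2 The scalar `S = Tr_ρ(κ·(lam − jE u₀))` in lane C: `|S| = exp(−2ℓ₀)`, `|S + ΘS| ≤ exp(−4k)` -/

/-- **`|S| = exp(−2ℓ₀)`** (lane C): `S = A_μ·Tr_ρ κ + B_μ·Tr_ρ(κα)`, `|B_μ| = |μ − ρμ|∕|α − ρα| = exp(−2(ℓ₀ + j))` EXACTLY (★ lane-C toolkit), `|Tr_ρ(κα)| = |κ|·|α − ρα| = exp(2j)`, and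
`|A_μ·Tr_ρ κ| < exp(−2ℓ₀)`. [cite: Jacobowitz1962, §4] [cite: Kottwitz1986BaseChangeUnits, §1 pp. 240–241] -/
theorem v_trace_depth_eq' {ϖ : E} (hϖ : Valued.v ϖ = exp (-1 : ℤ)) (jE : E →+* M) (hjsq : ∀ a, Valued.v (jE a) = Valued.v a ^ 2)
    (hjfix : ∀ z, ρ z = z ↔ ∃ c, jE c = z) (hρρ : ∀ x, ρ (ρ x) = x) (hvρ : ∀ x, Valued.v (ρ x) = Valued.v x)
    (hα1 : Valued.v α ≤ 1) (hDρ : IsRamifiedQuadraticDatum ρ ϖM dρ tρ) (hαρ : α - ρ α = ϖM - ρ ϖM)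
    {κ : M} (hκρ : Valued.v (κ + ρ κ) ≤ 1) {j : ℕ} (hκY : Valued.v κ * Valued.v (jE ϖ ^ j) * Valued.v (α - ρ α) = 1)
    (lam : M) {u₀ : E} {k' m' : ℕ}
    (hw' : Valued.v (lam - 1) ≤ Valued.v (jE ϖ ^ k')) (hum' : Valued.v (u₀ - 1) ≤ Valued.v (ϖ ^ m'))
    (hlev : IsOrd ρ α (jE ϖ ^ j) ((lam - 1) / jE ϖ ^ (d % 2))) (hnlev : ¬ IsOrd ρ α (jE ϖ ^ j) ((lam - 1) / jE ϖ ^ (d % 2 + 1)))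
    (hC5 : d % 2 + 1 ≤ k') (hC9 : k' ≤ m') :
    Valued.v (κ * (lam - jE u₀) + ρ (κ * (lam - jE u₀))) = exp (-(2 * ((d % 2 : ℕ) : ℤ))) := by
  have hϖM : Valued.v ϖM = exp (-1 : ℤ) := hDρ.2.2.1
  have hvαρ : Valued.v (α - ρ α) = exp (-(dρ : ℤ)) := by rw [hαρ, hDρ.2.2.2.2.1, v_varpi_pow hϖM]
  have hα : ρ α ≠ α := fun h => by rw [h, sub_self, map_zero] at hvαρ; exact exp_ne_zero hvαρ.symm
  have hpow := v_map_varpi_pow_sq hϖ jE hjsq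
  have hcc : Valued.v (jE ϖ ^ j) = exp (-(2 * (j : ℤ))) := hpow j
  have hκα : Valued.v κ * Valued.v (α - ρ α) = exp (2 * (j : ℤ)) := by
    have h1 : Valued.v (jE ϖ ^ j) * exp (2 * (j : ℤ)) = 1 := by rw [hcc, ← exp_add]; simp
    calc Valued.v κ * Valued.v (α - ρ α) = Valued.v κ * Valued.v (α - ρ α) * (Valued.v (jE ϖ ^ j) * exp (2 * (j : ℤ))) := by rw [h1, mul_one]
      _ = Valued.v κ * Valued.v (jE ϖ ^ j) * Valued.v (α - ρ α) * exp (2 * (j : ℤ)) := by simp only [mul_comm, mul_left_comm]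
      _ = exp (2 * (j : ℤ)) := by rw [hκY, one_mul]
  have hw : Valued.v (lam - 1) ≤ exp (-(2 * (k' : ℤ))) := by rw [hpow] at hw'; exact hw'
  have hμ : Valued.v (lam - jE u₀) ≤ exp (-(2 * (k' : ℤ))) := by
    have e : lam - jE u₀ = (lam - 1) - jE (u₀ - 1) := by rw [map_sub, map_one]; ring
    rw [e]
    refine (Valuation.map_sub _ _ _).trans (max_le hw ?_)
    rw [hjsq]
    have hu : Valued.v (u₀ - 1) ≤ exp (-(m' : ℤ)) := by rw [map_pow, v_varpi_pow hϖ] at hum'; exact hum'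
    refine (pow_le_pow_left' hu 2).trans ?_
    rw [← exp_nsmul, nsmul_eq_mul, exp_le_exp]; push_cast; omega
  obtain ⟨heq, hkj⟩ := v_sub_map_eq_of_tokens hϖ jE hjsq hjfix hDρ hαρ hw hC5 hlev hnlev
  set μ : M := lam - jE u₀ with hμdef
  have hμρ : μ - ρ μ = (lam - 1) - ρ (lam - 1) := by
    rw [hμdef, map_sub, map_sub, (hjfix _).2 ⟨u₀, rfl⟩, map_one]; ring
  obtain ⟨hB, hA⟩ := coords_fixed hρρ hα μ
  set B : M := (μ - ρ μ) / (α - ρ α) with hBdef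
  set A : M := μ - B * α with hAdef
  have hμAB : μ = A + B * α := by simp [A]
  have hvB : Valued.v B = exp (-(2 * ((d % 2 : ℕ) : ℤ) + 2 * j)) := by
    rw [hBdef, map_div₀, hμρ, heq, hvαρ, ← exp_sub]; congr 1; ring
  have hj1 : 1 < Valued.v κ * Valued.v (α - ρ α) := by rw [hκα, ← exp_zero, exp_lt_exp]; omega
  have hbig : Valued.v (B * (κ * α + ρ (κ * α))) = exp (-(2 * ((d % 2 : ℕ) : ℤ))) := by
    rw [map_mul, v_trace_mul_alpha_eq' hvρ hα1 hκρ hj1, hvB, hκα, ← exp_add]; congr 1; ring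
  have hAle : Valued.v A < exp (-(2 * ((d % 2 : ℕ) : ℤ))) := by
    refine lt_of_le_of_lt (Valuation.map_sub _ _ _) (max_lt (lt_of_le_of_lt hμ ?_) ?_)
    · rw [exp_lt_exp]; push_cast; omega
    · rw [map_mul, hvB]
      refine lt_of_le_of_lt (mul_le_of_le_one_right' hα1) ?_
      rw [exp_lt_exp]; push_cast; omega
  have hsmall : Valued.v (A * (κ + ρ κ)) < Valued.v (B * (κ * α + ρ (κ * α))) := by
    rw [hbig, map_mul]; exact lt_of_le_of_lt (mul_le_of_le_one_right' hκρ) hAle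
  have e : κ * μ + ρ (κ * μ) = B * (κ * α + ρ (κ * α)) + A * (κ + ρ κ) := by
    rw [hμAB, map_mul, map_add, map_mul, hA, hB, map_mul]; ring
  rw [e, Valuation.map_add_eq_of_lt_left _ hsmall, hbig]

/-- **`|S + ΘS| ≤ exp(−4k)`** (lane C): `S + ΘS = Tr_ρ(κ(lam − 1)²lam⁻¹) − Tr_σ(u₀ − 1)·Tr_ρ κ`; the first is `jE ϖ^{2k}·Tr_ρ(κζ₂)` with `ζ₂ = ((lam − 1)²∕jE ϖ^{2k})·lam⁻¹ ∈ 𝒪_j`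
(square token; `lam⁻¹ ∈ 𝒪_j`), integral by `v_trace_mul_le_one_of_isOrd'`; the second is `≤ exp(−4k)` by `Tr 𝔭^{m′} ⊆ 𝔭_F^{k}` (`2k ≤ m′ + d`).
[cite: Serre1979, Ch. III §3 Prop. 7] [cite: Jacobowitz1962, §4] -/
theorem v_trace_depth_add_map_le' (hD : IsRamifiedQuadraticDatum σ ϖ d t) (jE : E →+* M) (hjsq : ∀ a, Valued.v (jE a) = Valued.v a ^ 2)
    (hjfix : ∀ z, ρ z = z ↔ ∃ c, jE c = z) (hΘj : ∀ x, Θ (jE x) = jE (σ x))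
    (hρρ : ∀ x, ρ (ρ x) = x) (hvρ : ∀ x, Valued.v (ρ x) = Valued.v x) (hΘρ : ∀ x, Θ (ρ x) = ρ (Θ x)) (hvΘ : ∀ x, Valued.v (Θ x) = Valued.v x)
    (hα1 : Valued.v α ≤ 1) (hDρ : IsRamifiedQuadraticDatum ρ ϖM dρ tρ) (hαρ : α - ρ α = ϖM - ρ ϖM)
    {κ : M} (hΘκ : Θ κ = κ) (hκρ : Valued.v (κ + ρ κ) ≤ 1) {j : ℕ} (hκY : Valued.v κ * Valued.v (jE ϖ ^ j) * Valued.v (α - ρ α) = 1)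
    {lam : M} (hlam : Θ lam * lam = 1) {u₀ : E} {k m' : ℕ} (hum' : Valued.v (u₀ - 1) ≤ Valued.v (ϖ ^ m'))
    (hlev : IsOrd ρ α (jE ϖ ^ j) ((lam - 1) / jE ϖ ^ (d % 2))) (hsq : IsOrd ρ α (jE ϖ ^ j) ((lam - 1) ^ 2 / jE ϖ ^ (2 * k))) (hC6 : 2 * k ≤ m' + d) :
    Valued.v ((κ * (lam - jE u₀) + ρ (κ * (lam - jE u₀))) + Θ (κ * (lam - jE u₀) + ρ (κ * (lam - jE u₀)))) ≤ exp (-(4 * (k : ℤ))) := by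
  obtain ⟨hσ, hvσ, hϖ, hfix, hd, h1d, ht⟩ := hD
  have hϖM : Valued.v ϖM = exp (-1 : ℤ) := hDρ.2.2.1
  have hvαρ : Valued.v (α - ρ α) = exp (-(dρ : ℤ)) := by rw [hαρ, hDρ.2.2.2.2.1, v_varpi_pow hϖM]
  have hα : ρ α ≠ α := fun h => by rw [h, sub_self, map_zero] at hvαρ; exact exp_ne_zero hvαρ.symm
  have hpow := v_map_varpi_pow_sq hϖ jE hjsq
  have hcc : Valued.v (jE ϖ ^ j) = exp (-(2 * (j : ℤ))) := hpow j
  have hcc1 : Valued.v (jE ϖ ^ j) ≤ 1 := by rw [hcc, ← exp_zero, exp_le_exp]; omega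
  have hκcc : Valued.v κ * Valued.v (jE ϖ ^ j) * Valued.v (α - ρ α) ≤ 1 := hκY.le
  have hl1 : Valued.v lam = 1 := v_lam_eq_one hvΘ hlam
  have hl0 : lam ≠ 0 := fun h0 => by rw [h0, map_zero] at hl1; exact zero_ne_one hl1
  have h2k : Valued.v (jE ϖ ^ (2 * k)) = exp (-(4 * (k : ℤ))) := by rw [hpow]; congr 1; push_cast; ring
  have h2k0 : jE ϖ ^ (2 * k) ≠ 0 := fun h0 => by rw [h0, map_zero] at h2k; exact exp_ne_zero h2k.symm
  have hρϖ : ρ (jE ϖ) = jE ϖ := (hjfix _).2 ⟨ϖ, rfl⟩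
  -- `lam⁻¹ ∈ 𝒪_j` (from the level token)
  have hup : Valued.v ((lam - 1) - ρ (lam - 1)) ≤ exp (-(2 * ((d % 2 : ℕ) : ℤ) + 2 * j + dρ)) := by
    have hρℓ : ρ (jE ϖ ^ (d % 2)) = jE ϖ ^ (d % 2) := by rw [map_pow, hρϖ]
    have hne : Valued.v (jE ϖ ^ (d % 2)) ≠ 0 := by rw [hpow]; exact exp_ne_zero
    have h2 := ((isOrd_iff _ _ _ _).1 hlev).2
    rw [map_div₀, hρℓ, ← sub_div, map_div₀, div_le_iff₀ (zero_lt_iff.2 hne), map_mul, hvαρ, hpow, hpow, ← exp_add, ← exp_add] at h2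
    convert h2 using 2; ring
  have hlaminv : IsOrd ρ α (jE ϖ ^ j) lam⁻¹ := by
    rw [isOrd_iff, map_inv₀, hl1, inv_one]
    refine ⟨le_rfl, ?_⟩
    have e : lam⁻¹ - ρ lam⁻¹ = -(((lam - 1) - ρ (lam - 1)) / (lam * ρ lam)) := by
      rw [map_inv₀, map_sub, map_one]
      have hρl0 : ρ lam ≠ 0 := (map_ne_zero ρ).2 hl0
      field_simp
      ring
    rw [e, Valuation.map_neg, map_div₀, map_mul, hvρ, hl1, mul_one, div_one, map_mul, hvαρ, hcc, ← exp_add]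
    refine hup.trans ?_
    rw [exp_le_exp]; omega
  -- `Tr_ρ(c + Θc)` in two pieces
  have e1 : κ * (lam - jE u₀) + ρ (κ * (lam - jE u₀)) + Θ (κ * (lam - jE u₀) + ρ (κ * (lam - jE u₀))) =
      (κ * (lam - jE u₀) + Θ (κ * (lam - jE u₀))) + ρ (κ * (lam - jE u₀) + Θ (κ * (lam - jE u₀))) := by
    rw [map_add Θ, hΘρ, map_add ρ]; ring
  rw [e1, depth_add_map_eq jE hΘj hΘκ hlam u₀, mul_sub, map_sub ρ]
  have esplit : κ * ((lam - 1) ^ 2 * lam⁻¹) - κ * jE ((u₀ - 1) + σ (u₀ - 1)) + (ρ (κ * ((lam - 1) ^ 2 * lam⁻¹)) - ρ (κ * jE ((u₀ - 1) + σ (u₀ - 1)))) =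
      jE ϖ ^ (2 * k) * (κ * ((lam - 1) ^ 2 / jE ϖ ^ (2 * k) * lam⁻¹) + ρ (κ * ((lam - 1) ^ 2 / jE ϖ ^ (2 * k) * lam⁻¹))) -
        jE ((u₀ - 1) + σ (u₀ - 1)) * (κ + ρ κ) := by
    have hρjE : ∀ x, ρ (jE x) = jE x := fun x => (hjfix _).2 ⟨x, rfl⟩
    simp only [map_mul, map_div₀, map_pow, map_inv₀, map_sub, map_one, hρjE]
    field_simp
    ring
  rw [esplit]
  refine (Valuation.map_sub _ _ _).trans (max_le ?_ ?_)
  · rw [map_mul, h2k]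
    refine (mul_le_mul' le_rfl (v_trace_mul_le_one_of_isOrd' hρρ hvρ hα hα1 hcc1 hκρ hκcc (isOrd_mul hvρ hsq hlaminv))).trans ?_
    rw [mul_one]
  · rw [map_mul, hjsq]
    have hu : Valued.v (u₀ - 1) ≤ exp (-(m' : ℤ)) := by rw [map_pow, v_varpi_pow hϖ] at hum'; exact hum'
    refine (mul_le_mul' (pow_le_pow_left' (v_add_map_le_exp hσ hfix hϖ hd ht hu (m := k) (by omega)) 2) hκρ).trans ?_
    rw [mul_one, ← exp_nsmul, nsmul_eq_mul, exp_le_exp]; push_cast; omega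

/-! ## §3 HEAD — the lane-C axis letter is one class, with a `σ`-fixed unit scalar -/

/-- **HEAD — (AX-sh-C) «THE LETTER OF A UNIMODULAR AXIS LINE ON THE CLEAN SHELL IS ONE CLASS, AT EVERY ORDER LEVEL `j`» IN LANE C (RamM).**  Letters of `beta2CellsCFrame`:
the sheet datum on `E`, `|jE a| = |a|²`, the relative datum `IsRamifiedQuadraticDatum ρ ϖM dρ tρ` with `α − ρα = ϖM − ρϖM` and `dρ = 2r`, `|α| ≤ 1`, the ★ DEFS `ρ∕Θ` letters,
`Θ ∘ jE = jE ∘ σ`; the `κ` of a unimodular axis line at level `j` (`Θκ = κ`, `|κ + ρκ| ≤ 1`, `|κ|·|jE ϖ^j|·|α − ρα| = 1`); the block element with `Θlam·lam = 1` and the two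
DEEP letters `|lam − 1| ≤ |jE ϖ^{k′}|`, `|u₀ − 1| ≤ |ϖ^{m′}|` (free near `1`); the three shell tokens (level `d % 2`, not level `d % 2 + 1`, square level `2k`); and the arithmetic
`hC0 : d % 2 + 1 ≤ m`, `hC1 : m + r ≤ k′ + d − 1`, `hC3 : m + r ≤ 2n′`, `hC3′ : 2n′ ≤ m′ + d`, `hC4 : m + r + d % 2 ≤ 2k′`, `hC5 : d % 2 + 1 ≤ k′`, `hC6 : 2k ≤ m′ + d`,
`hC9 : k′ ≤ m′`, `hF5 : m + d ≤ 2k + 1`.  THEN `∃ e ∈ E`, `σe = e`, `|e| = 1`, with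
`{z ∣ ∃ ζ ∈ 𝒪_j, |(jE ϖ^m)⁻¹(jE z − Tr_ρ(κ(lam − jE u₀)·ζΘζ))| ≤ 1} = valueSetMod σ ϖ m (e • xPlus σ ϖ d)` — the `hdich` letter of ★ p862003 for lane C, V-shrunk.
[cite: Rogawski1990, §4.9 Prop. 4.9.1 (b) p. 55] [cite: Jacobowitz1962, §4] [cite: Serre1979, Ch. III §3 Prop. 7, Ch. V §3 Cor. 3] [cite: Kottwitz1986BaseChangeUnits, §1 pp. 240–241] -/
theorem exists_fixed_unit_lineValueSet_axis_eq_smul_xPlus_ramM (hD : IsRamifiedQuadraticDatum σ ϖ d t) (jE : E →+* M) (hjsq : ∀ a, Valued.v (jE a) = Valued.v a ^ 2)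
    (hjfix : ∀ z, ρ z = z ↔ ∃ c, jE c = z) (hΘj : ∀ x, Θ (jE x) = jE (σ x))
    (hρρ : ∀ x, ρ (ρ x) = x) (hvρ : ∀ x, Valued.v (ρ x) = Valued.v x) (hΘΘ : ∀ x, Θ (Θ x) = x) (hΘρ : ∀ x, Θ (ρ x) = ρ (Θ x))
    (hvΘ : ∀ x, Valued.v (Θ x) = Valued.v x) (hα1 : Valued.v α ≤ 1) (hDρ : IsRamifiedQuadraticDatum ρ ϖM dρ tρ) (hαρ : α - ρ α = ϖM - ρ ϖM)
    {r : ℕ} (hr : dρ = 2 * r)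
    {κ : M} (hΘκ : Θ κ = κ) (hκρ : Valued.v (κ + ρ κ) ≤ 1) {j : ℕ} (hκY : Valued.v κ * Valued.v (jE ϖ ^ j) * Valued.v (α - ρ α) = 1)
    {lam : M} (hlam : Θ lam * lam = 1) {u₀ : E} {m k k' m' n' : ℕ}
    (hw' : Valued.v (lam - 1) ≤ Valued.v (jE ϖ ^ k')) (hum' : Valued.v (u₀ - 1) ≤ Valued.v (ϖ ^ m'))
    (hlev : IsOrd ρ α (jE ϖ ^ j) ((lam - 1) / jE ϖ ^ (d % 2))) (hnlev : ¬ IsOrd ρ α (jE ϖ ^ j) ((lam - 1) / jE ϖ ^ (d % 2 + 1)))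
    (hsq : IsOrd ρ α (jE ϖ ^ j) ((lam - 1) ^ 2 / jE ϖ ^ (2 * k)))
    (hC0 : d % 2 + 1 ≤ m) (hC1 : m + r ≤ k' + d - 1) (hC3 : m + r ≤ 2 * n') (hC3' : 2 * n' ≤ m' + d) (hC4 : m + r + d % 2 ≤ 2 * k')
    (hC5 : d % 2 + 1 ≤ k') (hC6 : 2 * k ≤ m' + d) (hC9 : k' ≤ m') (hF5 : m + d ≤ 2 * k + 1) :
    ∃ e : E, σ e = e ∧ Valued.v e = 1 ∧
      {z : E | ∃ ζ : M, IsOrd ρ α (jE ϖ ^ j) ζ ∧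
          Valued.v ((jE ϖ ^ m)⁻¹ * (jE z - (κ * (lam - jE u₀) * (ζ * Θ ζ) + ρ (κ * (lam - jE u₀) * (ζ * Θ ζ))))) ≤ 1} =
        valueSetMod σ ϖ m (e • xPlus σ ϖ d) := by
  have hD' := hD
  obtain ⟨hσ, hvσ, hϖ, hfix, hd, h1d, ht⟩ := hD
  have hϖM : Valued.v ϖM = exp (-1 : ℤ) := hDρ.2.2.1
  have hvαρ : Valued.v (α - ρ α) = exp (-(dρ : ℤ)) := by rw [hαρ, hDρ.2.2.2.2.1, v_varpi_pow hϖM]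
  have hα : ρ α ≠ α := fun h => by rw [h, sub_self, map_zero] at hvαρ; exact exp_ne_zero hvαρ.symm
  have hjv : ∀ c, Valued.v (jE c) ≤ 1 ↔ Valued.v c ≤ 1 := v_map_le_one_iff_sq jE hjsq
  have hpow := v_map_varpi_pow_sq hϖ jE hjsq
  have hcc1 : Valued.v (jE ϖ ^ j) ≤ 1 := by rw [hpow, ← exp_zero, exp_le_exp]; omega
  have hm : Valued.v (jE ϖ ^ m) = exp (-(2 * (m : ℤ))) := hpow m
  have hm0 : Valued.v (jE ϖ ^ m) ≠ 0 := by rw [hm]; exact exp_ne_zero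
  set c : M := κ * (lam - jE u₀) with hcdef
  set S : M := c + ρ c with hSdef
  -- the scalar `s ∈ E` with `jE s = S`, its size and its trace
  obtain ⟨s, hs⟩ := (hjfix S).1 (map_add_map_eq hρρ c)
  have hvS : Valued.v S = exp (-(2 * ((d % 2 : ℕ) : ℤ))) :=
    v_trace_depth_eq' hϖ jE hjsq hjfix hρρ hvρ hα1 hDρ hαρ hκρ hκY lam hw' hum' hlev hnlev hC5 hC9
  have hvs : Valued.v s = exp (-((d % 2 : ℕ) : ℤ)) := by
    apply eq_exp_of_mul_self_eq
    rw [← pow_two, ← hjsq, hs, hvS]; congr 1; ring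
  have htr : Valued.v (s + σ s) ≤ exp (-(2 * (k : ℤ))) := by
    apply le_exp_of_mul_self_le
    rw [← pow_two, ← hjsq, map_add, ← hΘj, hs]
    refine (v_trace_depth_add_map_le' hD' jE hjsq hjfix hΘj hρρ hvρ hΘρ hvΘ hα1 hDρ hαρ hΘκ hκρ hκY hlam hum' hlev hsq hC6).trans ?_
    rw [exp_le_exp]; omega
  -- a skew element `ϖ^m`-close to `s`
  obtain ⟨z', hz', hsz'⟩ := exists_skew_near_of_trace_deep hσ hfix hϖ hd ht (a := s) (s := -(s + σ s)) (by ring)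
    (j := 2 * (k : ℤ)) (n := k) (m := m) (by rw [Valuation.map_neg]; exact htr) (by omega) (by omega)
  -- the reference scalar `t₊`
  set tp : E := (ϖ - σ ϖ) * ((ϖ * σ ϖ) ^ ((d - d % 2) / 2))⁻¹ with htpdef
  have htp0 : tp ≠ 0 := refSkewScalar_ne_zero hvσ hϖ hd
  have hvtp : Valued.v tp = exp (-((d % 2 : ℕ) : ℤ)) := v_refSkewScalar hvσ hϖ hd
  have hσtp : σ tp = -tp := map_refSkewScalar_eq_neg hσ _
  have hvz' : Valued.v z' = Valued.v s := by
    have hlt : Valued.v (s - z') < Valued.v s := by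
      rw [v_inv_varpi_pow_mul_le_one_iff hϖ] at hsz'
      rw [hvs]; refine lt_of_le_of_lt hsz' ?_; rw [exp_lt_exp]; omega
    have := Valuation.map_sub_eq_of_lt_left _ hlt
    rw [sub_sub_cancel] at this
    exact this
  refine ⟨z' * tp⁻¹, ?_, ?_, ?_⟩
  · rw [map_mul, map_inv₀, hz', hσtp, inv_neg, neg_mul_neg]
  · rw [map_mul, map_inv₀, hvz', hvs, hvtp, ← exp_neg, ← exp_add]; simp
  -- the set identity: letter = ray of `S` = class of `s·t₊⁻¹` = class of `z′·t₊⁻¹`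
  have hray := ray_eq_valueSetMod_smul_xPlus (ρ := ρ) (Θ := Θ) σ hvσ hϖ hd jE hjv hΘj hjfix c 0 hs m
  simp only [mul_zero, zero_add] at hray
  have hcongr : valueSetMod σ ϖ m ((s * tp⁻¹) • xPlus σ ϖ d) = valueSetMod σ ϖ m ((z' * tp⁻¹) • xPlus σ ϖ d) := by
    refine valueSetMod_smul_xPlus_congr hvσ ϖ d m ?_
    have e : (s * tp⁻¹ - z' * tp⁻¹) * tp = s - z' := by field_simp
    rw [← htpdef, e]; exact hsz'
  rw [← hcongr, ← hray]
  ext z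
  simp only [Set.mem_setOf_eq]
  constructor
  · rintro ⟨ζ, hζ, hz⟩
    obtain ⟨hB, hA⟩ := coords_fixed hρρ hα ζ
    obtain ⟨-, hA1⟩ := v_coords_le hα hα1 hcc1 hζ
    set A : M := ζ - (ζ - ρ ζ) / (α - ρ α) * α with hAdef
    obtain ⟨a, ha⟩ := (hjfix A).1 hA
    refine ⟨a, by rw [← hjv, ha]; exact hA1, ?_⟩
    have hest := v_value_sub_ray_le' hD' jE hjsq hjfix hΘj hρρ hvρ hΘΘ hΘρ hvΘ hα1 hDρ hαρ hr hΘκ hκY hlam hw' hum' hlev hnlev hC1 hC3 hC3' hC4 hC5 hC9 hζ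
    rw [← hAdef, ← ha, hΘj] at hest
    have hrayval : c * (jE a * Θ (jE a)) + ρ (c * (jE a * Θ (jE a))) = jE a * jE (σ a) * (c + ρ c) := by
      have hρN : ρ (jE a * jE (σ a)) = jE a * jE (σ a) := by rw [map_mul, (hjfix _).2 ⟨a, rfl⟩, (hjfix _).2 ⟨σ a, rfl⟩]
      rw [hΘj, show c * (jE a * jE (σ a)) = (jE a * jE (σ a)) * c by ring, map_mul ρ (jE a * jE (σ a)) c, hρN]; ring
    rw [hrayval]
    have e : (jE ϖ ^ m)⁻¹ * (jE z - jE a * jE (σ a) * (c + ρ c)) =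
        (jE ϖ ^ m)⁻¹ * (jE z - (c * (ζ * Θ ζ) + ρ (c * (ζ * Θ ζ)))) + (jE ϖ ^ m)⁻¹ * ((c * (ζ * Θ ζ) + ρ (c * (ζ * Θ ζ))) - jE a * jE (σ a) * (c + ρ c)) := by ring
    rw [e]
    refine (Valuation.map_add _ _ _).trans (max_le hz ?_)
    rw [map_mul, map_inv₀, hm, ← exp_neg, neg_neg]
    calc exp (2 * (m : ℤ)) * Valued.v (c * (ζ * Θ ζ) + ρ (c * (ζ * Θ ζ)) - jE a * jE (σ a) * (c + ρ c))
        ≤ exp (2 * (m : ℤ)) * exp (-(2 * (m : ℤ))) := mul_le_mul' le_rfl hest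
      _ = 1 := by rw [← exp_add]; simp
  · rintro ⟨a, ha, hz⟩
    exact ⟨jE a, isOrd_of_fixed ((hjfix _).2 ⟨a, rfl⟩) ((hjv a).2 ha), hz⟩

end Summit.HodgeConjecture.HodgeConjecture.Cruxes.H413.F0P3cDyRamAxisLetterEstimatesRamM

end
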